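import Summits.QuantumFields.YangMills.Theorems.SmallFieldWideningLargeFieldMassRefinementTailBaseTailFirstRun
import Summits.QuantumFields.YangMills.Theorems.SmallFieldWideningPlainStabAddOfLocalStepFloor

/-!
# Route `SmallFieldWidening`, crux r3 `LargeFieldMassRefinementTail` (stmt-QuantumFields-22884) and child crux r4 `PlainStabAdd`
# (stmt-QuantumFields-27718), line `birth` — support file: THE INTERFACE OF RECORD `LocalStepFloor` WITH ITS (base) CONJUNCT DISCHARGED
# AT THE FIRST RUN (`k₀ = 1`): `StepOnlyFirstRun ⇒ LocalStepFloor ⇒ PlainStabAdd ⇒ LargeFieldMassRefinementTail`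

Width seat `ym-line-sfw-p2-w2` (gen 47).  WHAT.  The registered stub `stub_localStepFloor` of `Cruxes/LargeFieldMassRefinementTail/Lines/birth.lean`
(v9; = hypothesis `hLS` of `PlainStabAddOfLocalStepFloor.largeFieldMassRefinementTail_of_localStepFloor`) asks the supplier for a starting
run `k₀ ≥ 1`, a (base) tail at run `k₀` with a rate floor `c_b` fixed before the precision `η`, an interval-summable slack, a polynomial
guard, and the one-step comparison (step) for `K ≥ k₀`.  `…BaseTailFirstRun.baseClause_firstRun` PROVES the (base) tail at `k₀ = 1` for
every threshold multiplier `t ∈ [1/2,1]`.  Hence ★★ `localStepFloor_of_stepOnlyFirstRun`: the stub follows from its (slack) ∧ (card) ∧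
(step) conjuncts alone, stated from the first run (`k ≥ 1`, `K ≥ 1`) and without `c_b, C_b, N_b, k₀` — the formula `StepOnlyFirstRun`
spelled out as the hypothesis (no definition is introduced); ★ `plainStabAdd_of_stepOnlyFirstRun`, ★ `largeFieldMassRefinementTail_of_stepOnlyFirstRun`:
cruxes r4 and r3 BY NAME from it (through the landed glue).  A lead may therefore RESHAPE the line's one stub to `StepOnlyFirstRun`
(smaller signature, same composition); this file is the one-line closer for that reshape.
WHAT THIS IS NOT.  `StepOnlyFirstRun` is NOT proved (it is the cutoff-uniform EVENT-level one-step small-field comparison, open in print: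
[Balaban1985UV3] (70)–(71), [Balaban1987RG1] Thm 1, [Balaban1989LargeFieldII] §1 deliver densities, not event probabilities); cruxes
22884 / 27718 stay OPEN; rung R3 is a RECORD rung; the YM mass gap is NOT proved by any of this.
-/

noncomputable section

namespace Summit.QuantumFields.YangMills.Theorems.LargeFieldMassRefinementTailStepOnly

open MeasureTheory
open scoped BigOperators
open Literature.MathematicalPhysics.QuantumFieldTheory.Balaban1983to89
open Literature.MathematicalPhysics.QuantumFieldTheory.Balaban1983to89.T3ContinuumYM3Torus
open Literature.MathematicalPhysics.QuantumFieldTheory.Balaban1983to89.T3UnitScaleTilt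
open Literature.MathematicalPhysics.QuantumFieldTheory.Balaban1983to89.T3UnitLawDensityEML (ℰp)
open Literature.MathematicalPhysics.QuantumFieldTheory.Balaban1983to89.T3LevelShift
open Summit.QuantumFields.YangMills.Theorems.LargeFieldMassRefinementTailBaseTail (baseClause_firstRun)
open Summit.QuantumFields.YangMills.Theorems.PlainStabAddOfLocalStepFloor
  (plainStabAdd_of_localStepFloor largeFieldMassRefinementTail_of_localStepFloor)

/-- ★★ **`LocalStepFloor` ⇐ `StepOnlyFirstRun`**: the interface of record with `k₀ := 1` and its (base) conjunct supplied by
`baseClause_firstRun` (rate floor `c_b(L)`, power `N_b`, prefactor `C_b(L,b₀,p₀)`, coupling window `γ₁ := min(γ₁^step, γ₁^base)`).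
The hypothesis is (slack) ∧ (card) ∧ (step) from the first run, verbatim otherwise. [cite: Balaban1985UV3, (7) p.257 and (70)-(71) p.273] -/
theorem localStepFloor_of_stepOnlyFirstRun
    (hS : ∀ (L : ℕ) (b₀ p₀ : ℝ), 0 < b₀ → 2 < p₀ → ∃ b' : ℝ, 0 < b' ∧ ∀ η : ℝ, 0 < η →
      ∃ (M : ℕ) (γ₁ A : ℝ), 0 < γ₁ ∧ γ₁ ≤ 1 ∧
      ∀ (F : T3Family) (γ : ℝ), F.L = L → 0 < γ → γ ≤ γ₁ →
        ∀ q : Plaq (F.P 0) 0, ∃ (ρ t : ℕ → ℝ) (S : (K : ℕ) → Finset (Plaq (F.P (K + 1)) 0)),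
          (∀ K : ℕ, 1 / 2 ≤ t K ∧ t K ≤ 1) ∧
          (∀ k K : ℕ, 1 ≤ k → ∑ j ∈ Finset.Ico k K, ρ j ≤ A + η * B10.pFun b₀ p₀ (Real.sqrt γ) ^ 2) ∧
          (∀ K : ℕ, 1 ≤ K → ((S K).card : ℝ) ≤ ((F.L : ℝ) ^ (K + 1)) ^ M) ∧
          ∀ K : ℕ, 1 ≤ K →
            (gibbsK F ℰp γ (K + 1)).real ({U | t (K + 1) * θBal F.L γ b₀ p₀ 0 ≤ GaugeGroup.dist1 (GaugeField.plaqHol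
                (Averaging.iter (fun i => BlockAveraging.blockAvg (P := F.P (K + 1)) (j := i) ℰp) (K + 1) U)
                (plaqShift (F.sitesPerDir_unit (K + 1)) q))} ∩
              {U | PlaqSmallOn (↑(S K) : Set (Plaq (F.P (K + 1)) 0)) (θBal F.L γ b' p₀ (K + 1)) U}) ≤
            Real.exp (ρ K) *
            (gibbsK F ℰp γ K).real {U | t K * θBal F.L γ b₀ p₀ 0 ≤ GaugeGroup.dist1 (GaugeField.plaqHol
                (Averaging.iter (fun i => BlockAveraging.blockAvg (P := F.P K) (j := i) ℰp) K U)
                (plaqShift (F.sitesPerDir_unit K) q))}) :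
    ∀ (L : ℕ) (b₀ p₀ : ℝ), 0 < b₀ → 2 < p₀ → ∃ (cb b' : ℝ), 0 < cb ∧ 0 < b' ∧ ∀ η : ℝ, 0 < η →
      ∃ (k₀ Nb M : ℕ) (γ₁ Cb A : ℝ), 1 ≤ k₀ ∧ 0 < γ₁ ∧ γ₁ ≤ 1 ∧ 0 ≤ Cb ∧
      ∀ (F : T3Family) (γ : ℝ), F.L = L → 0 < γ → γ ≤ γ₁ →
        ∀ q : Plaq (F.P 0) 0, ∃ (ρ t : ℕ → ℝ) (S : (K : ℕ) → Finset (Plaq (F.P (K + 1)) 0)),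
          (∀ K : ℕ, 1 / 2 ≤ t K ∧ t K ≤ 1) ∧
          (gibbsK F ℰp γ k₀).real {U | t k₀ * θBal F.L γ b₀ p₀ 0 ≤ GaugeGroup.dist1 (GaugeField.plaqHol
                (Averaging.iter (fun i => BlockAveraging.blockAvg (P := F.P k₀) (j := i) ℰp) k₀ U) (plaqShift (F.sitesPerDir_unit k₀) q))} ≤
            Cb * (γ⁻¹) ^ Nb * Real.exp (-(cb * B10.pFun b₀ p₀ (Real.sqrt γ) ^ 2)) ∧
          (∀ k K : ℕ, k₀ ≤ k → ∑ j ∈ Finset.Ico k K, ρ j ≤ A + η * B10.pFun b₀ p₀ (Real.sqrt γ) ^ 2) ∧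
          (∀ K : ℕ, k₀ ≤ K → ((S K).card : ℝ) ≤ ((F.L : ℝ) ^ (K + 1)) ^ M) ∧
          ∀ K : ℕ, k₀ ≤ K →
            (gibbsK F ℰp γ (K + 1)).real ({U | t (K + 1) * θBal F.L γ b₀ p₀ 0 ≤ GaugeGroup.dist1 (GaugeField.plaqHol
                (Averaging.iter (fun i => BlockAveraging.blockAvg (P := F.P (K + 1)) (j := i) ℰp) (K + 1) U)
                (plaqShift (F.sitesPerDir_unit (K + 1)) q))} ∩
              {U | PlaqSmallOn (↑(S K) : Set (Plaq (F.P (K + 1)) 0)) (θBal F.L γ b' p₀ (K + 1)) U}) ≤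
            Real.exp (ρ K) *
            (gibbsK F ℰp γ K).real {U | t K * θBal F.L γ b₀ p₀ 0 ≤ GaugeGroup.dist1 (GaugeField.plaqHol
                (Averaging.iter (fun i => BlockAveraging.blockAvg (P := F.P K) (j := i) ℰp) K U)
                (plaqShift (F.sitesPerDir_unit K) q))} := by
  intro L b₀ p₀ hb₀ hp₀
  obtain ⟨b', hb', hη⟩ := hS L b₀ p₀ hb₀ hp₀
  obtain ⟨cb, Nb, γ₁b, Cb, hcb, hγ₁b, hγ₁b1, hCb, hbase⟩ := baseClause_firstRun L b₀ p₀ hb₀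
  refine ⟨cb, b', hcb, hb', fun η hηpos => ?_⟩
  obtain ⟨M, γ₁s, A, hγ₁s, hγ₁s1, hstep⟩ := hη η hηpos
  refine ⟨1, Nb, M, min γ₁s γ₁b, Cb, A, le_rfl, lt_min hγ₁s hγ₁b, (min_le_left _ _).trans hγ₁s1, hCb,
    fun F γ hF hγ hγ₁ q => ?_⟩
  obtain ⟨ρ, t, S, ht, hslack, hcard, hst⟩ := hstep F γ hF hγ (hγ₁.trans (min_le_left _ _)) q
  exact ⟨ρ, t, S, ht, hbase F γ hF hγ (hγ₁.trans (min_le_right _ _)) q (t 1) (ht 1).1 (ht 1).2, hslack, hcard, hst⟩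

/-- ★ **Crux r4 `PlainStabAdd` (stmt-QuantumFields-27718) BY NAME ⇐ `StepOnlyFirstRun`** (through `plainStabAdd_of_localStepFloor`).
Conditional certificate; the hypothesis is NOT proved. [cite: Balaban1985UV3, (70)-(71) p.273; Balaban1987RG1, Thm 1 p.259] -/
theorem plainStabAdd_of_stepOnlyFirstRun
    (hS : ∀ (L : ℕ) (b₀ p₀ : ℝ), 0 < b₀ → 2 < p₀ → ∃ b' : ℝ, 0 < b' ∧ ∀ η : ℝ, 0 < η →
      ∃ (M : ℕ) (γ₁ A : ℝ), 0 < γ₁ ∧ γ₁ ≤ 1 ∧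
      ∀ (F : T3Family) (γ : ℝ), F.L = L → 0 < γ → γ ≤ γ₁ →
        ∀ q : Plaq (F.P 0) 0, ∃ (ρ t : ℕ → ℝ) (S : (K : ℕ) → Finset (Plaq (F.P (K + 1)) 0)),
          (∀ K : ℕ, 1 / 2 ≤ t K ∧ t K ≤ 1) ∧
          (∀ k K : ℕ, 1 ≤ k → ∑ j ∈ Finset.Ico k K, ρ j ≤ A + η * B10.pFun b₀ p₀ (Real.sqrt γ) ^ 2) ∧
          (∀ K : ℕ, 1 ≤ K → ((S K).card : ℝ) ≤ ((F.L : ℝ) ^ (K + 1)) ^ M) ∧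
          ∀ K : ℕ, 1 ≤ K →
            (gibbsK F ℰp γ (K + 1)).real ({U | t (K + 1) * θBal F.L γ b₀ p₀ 0 ≤ GaugeGroup.dist1 (GaugeField.plaqHol
                (Averaging.iter (fun i => BlockAveraging.blockAvg (P := F.P (K + 1)) (j := i) ℰp) (K + 1) U)
                (plaqShift (F.sitesPerDir_unit (K + 1)) q))} ∩
              {U | PlaqSmallOn (↑(S K) : Set (Plaq (F.P (K + 1)) 0)) (θBal F.L γ b' p₀ (K + 1)) U}) ≤
            Real.exp (ρ K) *
            (gibbsK F ℰp γ K).real {U | t K * θBal F.L γ b₀ p₀ 0 ≤ GaugeGroup.dist1 (GaugeField.plaqHol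
                (Averaging.iter (fun i => BlockAveraging.blockAvg (P := F.P K) (j := i) ℰp) K U)
                (plaqShift (F.sitesPerDir_unit K) q))}) :
    Summit.QuantumFields.YangMills.Theses.SmallFieldWidening.PlainStabAdd :=
  plainStabAdd_of_localStepFloor (localStepFloor_of_stepOnlyFirstRun hS)

/-- ★ **Crux r3 `LargeFieldMassRefinementTail` (stmt-QuantumFields-22884) BY NAME ⇐ `StepOnlyFirstRun`** (through
`largeFieldMassRefinementTail_of_localStepFloor`): the one-line closer of a reshape of line `birth` to the stub `StepOnlyFirstRun`.
Conditional certificate; the hypothesis is NOT proved. [cite: Balaban1985UV3, (70)-(71) p.273; Balaban1987RG1, Thm 1 p.259] -/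
theorem largeFieldMassRefinementTail_of_stepOnlyFirstRun
    (hS : ∀ (L : ℕ) (b₀ p₀ : ℝ), 0 < b₀ → 2 < p₀ → ∃ b' : ℝ, 0 < b' ∧ ∀ η : ℝ, 0 < η →
      ∃ (M : ℕ) (γ₁ A : ℝ), 0 < γ₁ ∧ γ₁ ≤ 1 ∧
      ∀ (F : T3Family) (γ : ℝ), F.L = L → 0 < γ → γ ≤ γ₁ →
        ∀ q : Plaq (F.P 0) 0, ∃ (ρ t : ℕ → ℝ) (S : (K : ℕ) → Finset (Plaq (F.P (K + 1)) 0)),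
          (∀ K : ℕ, 1 / 2 ≤ t K ∧ t K ≤ 1) ∧
          (∀ k K : ℕ, 1 ≤ k → ∑ j ∈ Finset.Ico k K, ρ j ≤ A + η * B10.pFun b₀ p₀ (Real.sqrt γ) ^ 2) ∧
          (∀ K : ℕ, 1 ≤ K → ((S K).card : ℝ) ≤ ((F.L : ℝ) ^ (K + 1)) ^ M) ∧
          ∀ K : ℕ, 1 ≤ K →
            (gibbsK F ℰp γ (K + 1)).real ({U | t (K + 1) * θBal F.L γ b₀ p₀ 0 ≤ GaugeGroup.dist1 (GaugeField.plaqHol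
                (Averaging.iter (fun i => BlockAveraging.blockAvg (P := F.P (K + 1)) (j := i) ℰp) (K + 1) U)
                (plaqShift (F.sitesPerDir_unit (K + 1)) q))} ∩
              {U | PlaqSmallOn (↑(S K) : Set (Plaq (F.P (K + 1)) 0)) (θBal F.L γ b' p₀ (K + 1)) U}) ≤
            Real.exp (ρ K) *
            (gibbsK F ℰp γ K).real {U | t K * θBal F.L γ b₀ p₀ 0 ≤ GaugeGroup.dist1 (GaugeField.plaqHol
                (Averaging.iter (fun i => BlockAveraging.blockAvg (P := F.P K) (j := i) ℰp) K U)
                (plaqShift (F.sitesPerDir_unit K) q))}) :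
    Summit.QuantumFields.YangMills.Theses.SmallFieldWidening.LargeFieldMassRefinementTail :=
  largeFieldMassRefinementTail_of_localStepFloor (localStepFloor_of_stepOnlyFirstRun hS)

end Summit.QuantumFields.YangMills.Theorems.LargeFieldMassRefinementTailStepOnly

end
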